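import Mathlib
import Summits.Ventures.PercRepro2.PosClassSplit

/-!
# The placement `s, w | u, v` across a cut vertex
(blind cell PercRepro2, p5 g8, 2026-08-26; `proofs/P5-POSCLASS.md` §2′)

The last placement of the four marks across a cut vertex `x`: the root `s` and the conditioning
vertex `w` on one side, the two marks `u, v` on the other.  By the `0/1` cases of `1_{x ∈ C(s)}`,
`N_s(f_u f_v · k) = N_A(kRed(s, x) k) · N_B(r_u r_v) + N_A(kBlue(s, x) k) · N_B(r_u' r_v') +
N_A(kCore(s, x) k) · N_B(f^x_u f^x_v)` for every `A`-side kernel `k` (`stat_split_sw`) — three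
products of nonnegative counts, the last `B`-factor being typed Harris at the root `x` — so (TB13)
and (OS) hold OUTRIGHT on this placement (`classPair_split_sw`).  With `PosClassCut`, `PosClassOS`,
`PosClassMarks` and `PosClassSplit` this completes the one-step transports of the pair
{(TB13), (OS)} for every placement of `s, u, v, w` across a cut vertex.  Own work; standard axioms.
-/

namespace Summit.Ventures.PercRepro2

namespace PosClass

open CovForm A3InactiveTyped CutV TB14Cut

section SplitSW

variable {V : Type*} {E : Type*} [Fintype E] [DecidableEq E] {R : Type*} [Field R]
  [LinearOrder R] [IsStrictOrderedRing R]
  {ends : E → Sym2 V} {x : V} {VA VB : Set V} {EA EB : Set E}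
  [DecidablePred (· ∈ EA)] [DecidablePred (· ∈ EB)]

omit [Fintype E] [DecidableEq E] [LinearOrder R] [IsStrictOrderedRing R] in
/-- The pointwise composition for the placement `s, w` on the `A`-side and `u, v` on the `B`-side:
`f_u f_v k(s, w) = kRed(s, x) k(s, w) · r_u r_v + kBlue(s, x) k(s, w) · r_u' r_v' + kCore(s, x) k(s, w) ·
f^x_u f^x_v` for any kernel `k` (the `0/1` cases of `1_{x ∈ C(s)}`). -/
lemma odd_mul_split_sw (h : IsCut ends x VA VB EA EB) {s u v : V} (hs : s ∈ VA ∪ {x})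
    (hu : u ∈ VB) (hv : v ∈ VB) (k : Config E → Config E → R) (y y' : Config E) :
    (odd ends s u y y' * odd ends s v y y' * k y y' : R) =
      kRed ends s x y y' * k y y' * (iL ends x u y * iL ends x v y) +
      kBlue ends s x y y' * k y y' * (iL ends x u y' * iL ends x v y') +
      kCore ends s x y y' * k y y' * (odd ends x u y y' * odd ends x v y y') := by
  have e1 := iL_across (R := R) h hs hu y
  have e2 := iL_across (R := R) h hs hu y'
  have e3 := iL_across (R := R) h hs hv y
  have e4 := iL_across (R := R) h hs hv y'
  unfold odd kRed kBlue kCore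
  rw [e1, e2, e3, e4]
  rcases iL_zero_or_one (R := R) ends s x y with ha | ha <;>
    rcases iL_zero_or_one (R := R) ends s x y' with ha' | ha' <;> rw [ha, ha'] <;> ring

omit [LinearOrder R] [IsStrictOrderedRing R] in
/-- **The placement `s, w | u, v`**: for any `A`-side class kernel `k` of `(s, w)`,
`N_s(f_u f_v · k) = N_A(kRed(s, x) k) · N_B(r_u r_v) + N_A(kBlue(s, x) k) · N_B(r_u' r_v') +
N_A(kCore(s, x) k) · N_B(f^x_u f^x_v)` — three products of nonnegative counts (the last `B`-factor is
typed Harris at the root `x`). -/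
theorem stat_split_sw (h : IsCut ends x VA VB EA EB) (F : Finset E) (z : Config E)
    {s u v : V} (hs : s ∈ VA ∪ {x}) (hu : u ∈ VB) (hv : v ∈ VB) (k : Config E → Config E → R)
    (hk : ∀ y y', k y y' = k (restrict EA y) (restrict EA y')) :
    (stat F z ends s u v k : R) =
      pairCount (sideFree EA F) (restrict EA z) (fun y y' => kRed ends s x y y' * k y y') *
        pairCount (sideFree EB F) (restrict EB z) (fun y _ => iL ends x u y * iL ends x v y) +
      pairCount (sideFree EA F) (restrict EA z) (fun y y' => kBlue ends s x y y' * k y y') *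
        pairCount (sideFree EB F) (restrict EB z) (fun _ y' => iL ends x u y' * iL ends x v y') +
      pairCount (sideFree EA F) (restrict EA z) (fun y y' => kCore ends s x y y' * k y y') *
        pairCount (sideFree EB F) (restrict EB z)
          (fun y y' => odd ends x u y y' * odd ends x v y y') := by
  have hA := iL_sx_restrictA (R := R) h hs
  have hBu : ∀ y : Config E, (iL ends x u y : R) = iL ends x u (restrict EB y) :=
    fun y => iL_restrictB h (Or.inr rfl) (Or.inl hu) y
  have hBv : ∀ y : Config E, (iL ends x v y : R) = iL ends x v (restrict EB y) :=
    fun y => iL_restrictB h (Or.inr rfl) (Or.inl hv) y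
  have e1 := pairCount_mul_of_cut (R := R) h F z (fun y y' => kRed ends s x y y' * k y y')
    (fun y _ => iL ends x u y * iL ends x v y)
    (by intro y y'; rw [kRed_restrict hA y y', hk y y'])
    (by intro y y'; rw [hBu y, hBv y])
  have e2 := pairCount_mul_of_cut (R := R) h F z (fun y y' => kBlue ends s x y y' * k y y')
    (fun _ y' => iL ends x u y' * iL ends x v y')
    (by intro y y'; rw [kBlue_restrict hA y y', hk y y'])
    (by intro y y'; rw [hBu y', hBv y'])
  have e3 := pairCount_mul_of_cut (R := R) h F z (fun y y' => kCore ends s x y y' * k y y')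
    (fun y y' => odd ends x u y y' * odd ends x v y y')
    (by intro y y'; rw [kCore_restrict hA y y', hk y y'])
    (by intro y y'; rw [odd_restrictB h hu y y', odd_restrictB h hv y y'])
  have hsum : (stat F z ends s u v k : R) =
      pairCount F z (fun y y' => kRed ends s x y y' * k y y' * (iL ends x u y * iL ends x v y)) +
      pairCount F z (fun y y' => kBlue ends s x y y' * k y y' *
        (iL ends x u y' * iL ends x v y')) +
      pairCount F z (fun y y' => kCore ends s x y y' * k y y' *
        (odd ends x u y y' * odd ends x v y y')) := by
    rw [← pairCount_add, ← pairCount_add]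
    unfold stat pairCount
    refine Finset.sum_congr rfl fun y _ => ?_
    split_ifs
    · simp only [odd_mul_split_sw h hs hu hv k]
    · rfl
  rw [hsum, e1, e2, e3]

/-- **(TB13) and (OS) hold outright on the placement `s, w | u, v`.** -/
theorem classPair_split_sw (h : IsCut ends x VA VB EA EB) (F : Finset E) (z : Config E)
    {s u v w : V} (hs : s ∈ VA ∪ {x}) (hu : u ∈ VB) (hv : v ∈ VB) (hw : w ∈ VA ∪ {x}) :
    0 ≤ (stat F z ends s u v (kOut ends s w) : R) ∧
    0 ≤ (stat F z ends s u v (kOut ends s w) : R) + stat F z ends s u v (kRed ends s w) ∧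
    0 ≤ (stat F z ends s u v (kOut ends s w) : R) + stat F z ends s u v (kBlue ends s w) := by
  have hkO := kOut_restrict (R := R) (S := EA) (fun y => iL_restrictA h hs hw y)
  have hkR := kRed_restrict (R := R) (S := EA) (fun y => iL_restrictA h hs hw y)
  have hkB := kBlue_restrict (R := R) (S := EA) (fun y => iL_restrictA h hs hw y)
  have b1 := pairCount_nonneg' (R := R) (sideFree EB F) (restrict EB z)
    (fun y _ => iL ends x u y * iL ends x v y)
    (fun y _ => mul_nonneg (iL_nonneg ends x u y) (iL_nonneg ends x v y))
  have b2 := pairCount_nonneg' (R := R) (sideFree EB F) (restrict EB z)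
    (fun _ y' => iL ends x u y' * iL ends x v y')
    (fun _ y' => mul_nonneg (iL_nonneg ends x u y') (iL_nonneg ends x v y'))
  have b3 := stat_one_nonneg (R := R) (sideFree EB F) (restrict EB z) ends x u v
  have nn : ∀ (k₁ k₂ : Config E → Config E → R), (∀ y y', 0 ≤ k₁ y y') → (∀ y y', 0 ≤ k₂ y y') →
      0 ≤ pairCount (sideFree EA F) (restrict EA z) (fun y y' => k₁ y y' * k₂ y y') :=
    fun k₁ k₂ h₁ h₂ => pairCount_nonneg' _ _ _ (fun y y' => mul_nonneg (h₁ y y') (h₂ y y'))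
  have t : ∀ k : Config E → Config E → R, (∀ y y', 0 ≤ k y y') →
      (∀ y y', k y y' = k (restrict EA y) (restrict EA y')) → 0 ≤ (stat F z ends s u v k : R) := by
    intro k hk hkr
    rw [stat_split_sw h F z hs hu hv k hkr]
    exact add_nonneg (add_nonneg (mul_nonneg (nn _ _ (kRed_nonneg ends s x) hk) b1)
      (mul_nonneg (nn _ _ (kBlue_nonneg ends s x) hk) b2))
      (mul_nonneg (nn _ _ (kCore_nonneg ends s x) hk) b3)
  have o := t (kOut ends s w) (kOut_nonneg ends s w) hkO
  have r := t (kRed ends s w) (kRed_nonneg ends s w) hkR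
  have b := t (kBlue ends s w) (kBlue_nonneg ends s w) hkB
  exact ⟨o, add_nonneg o r, add_nonneg o b⟩

end SplitSW

end PosClass

end Summit.Ventures.PercRepro2
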